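import Summits.QuantumFields.YangMills.Theorems.FluctuationComparisonRegPrIntLOrganTangentTelescopeWindowPath
import Summits.QuantumFields.YangMills.Theorems.FluctuationComparisonRegPrIntLOrganTangentSmallStepOneBond
import Literature.MathematicalPhysics.QuantumFieldTheory.Balaban1983to89.B15SU2ChartHolomorphic
import HarnessLib

/-!
# TN-ANCHOR-FREE + TN-OSC (ideator `ym-r3-idea-1` g27, crux 20520, v18 H-currency): the flat ANCHOR LETTER comes from the scaled pair
# clause ITSELF, and the SUP-OSCILLATION of the organ's remainder along a window path from `1` is bounded by path length² × letters

Cell `ym3-torus` (YM ladder rung R3 = continuum `SU(2)` Yang–Mills on the three-torus — a RUNG, NOT d = 4, NOT infinite volume, NOT a mass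
gap, NOT Clay).  Crux workfile of `stmt-QuantumFields-20520` (`FluctuationComparisonRegPrIntL`); lemma file, kernel-checked, NOT a line, NOT a
registry act (★★OWNER RULING №36: registered skeleton `Lines/semiclassical_s2beta.lean` v11.4 untouched; `Lines/runpair_organ.lean` v17.2
untouched here).

WHAT THIS SHOWS (bookkeeping over the tree's bricks ✓p797413 `…OrganTangentTelescopeWindowPath` (LEAD w3 g24, brick T) and ✓p797395
`…OrganTangentSmallStepOneBond` (w4 g22, P-a)).

* §1 `expPt (−v) = (expPt v)⁻¹` (restated from the crux file `GRChartOdd.lean`, (ii′)), `dist1 (expPt (−v)) = dist1 (expPt v)`.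
* §2 ABSTRACT SUP-OSCILLATION ALONG A PATH (any state space; the windowed clause of brick T §1): anchors `≤ A·sz` at the start, column entries
  `k bᵢ b_l·sz mᵢ ≤ κ`, steps `sz ≤ σ`, `n` steps ⟹ ★`osc_of_anchor_and_length_on`: `|f Uend − f U₀| ≤ n·(A + n·κ)·σ` (moving-anchor induction:
  after each step the anchor constant grows by `κ`, brick T's `firstDiff_step_on`).
* §3 THE ORGAN (right exponential one-bond moves of `SU(2)` gauge fields, the `HClauseSq` TEXT `h` carried VERBATIM as in brick T §2):
  ★★`anchor_of_clause_of_even` — TN-ANCHOR-FREE: instantiate the clause's square at `b′ = b`, `v′ = −v`, fourth corner `Z = U₀` (legal because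
  `expPt v · expPt (−v) = 1`), and use EVENNESS `R (U₀-excitation by −v) = R (U₀-excitation by v)`: the square's alternating sum is
  `2·(R U₀ − R V)`, whence `|R V − R U₀| ≤ (k b b ∕ 2)·(‖v‖∕θ)²` — a SECOND-ORDER anchor letter with NO analyticity ∕ (β) input at that height;
  ★`flat_anchor_of_clause` — at `U₀ = 1` evenness is the tree's ✓p793256 `…FlatAnchorEven.flatBond_apply_inv_eq` shape
  `R (update 1 b g⁻¹) = R (update 1 b g)` (gauge invariance; every `SU(2)` element is conjugate to its inverse), taken as hypothesis `hinv`;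
  ★★`osc_flat_window_path_le` — TN-OSC: for a path of `n` window-size steps from `1` (all prefixes and their probe-∕(−probe)-excitations
  `θ`-small, step sizes `‖vᵢ‖∕θ ≤ σ ≤ r`, letters `0 ≤ k ≤ K` on the path's bonds):  `|R Uend − R 1| ≤ n·(K·σ∕2 + n·K·σ)·σ ≤ … = O(K·(nσ)²)`.

WHY (v18 junction `directTransport_supR`, spec `V18-TYPING-SPEC-w3g24.md` §4∕§4b): (A) the anchor at the OUTPUT height `j` needs no (β)∕S1ᴴ there —
the output clause of O1ᵘ-H alone gives it (spec §3 edit (E) and brick «M-β-marg» become unnecessary; S1ᴴ is needed only at the SEED height for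
TopConversion); (B) what ✓`FlatRatioTermination.stub_windowTV` consumes of S3 is only `hstep1 : ∀ U ∈ inner window, |r U − r 1| ≤ δ₀` (its proof,
l.115–127), i.e. an inner-window SUP-OSCILLATION — exactly the shape `osc_flat_window_path_le` delivers from O1ᵘ-H's output clause + a small-step
window path (w4 g22 P-b ∕ P-b′); so S3ᴴ's conclusion can be the sup-oscillation text and ULC re-keys through a WindowTV variant with `hstep1` as
hypothesis (no S4a chains inside WindowTV; S4a∘P-b moves into the junction).

HONEST: elementary bookkeeping (triangle inequalities and an induction); nothing of Bałaban's asserted; the clause `h` (O1ᵘ-H's output for the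
runs) and `hinv` are HYPOTHESES; O1∕O1ᵘ-H∕S3ᴴ∕crux 20520∕`YM3TorusSU2` NOT proved; no summit is proved by a lemma file.  R3 = SU(2) YM₃ on T³ at
fixed lattice data — NOT d = 4, NOT infinite volume, NOT a mass gap, NOT Clay; the Yang–Mills mass gap is NOT proved.
-/

noncomputable section

open Function
open Literature.MathematicalPhysics.QuantumFieldTheory.Balaban1983to89
open T4CubeChartGnomonic (SU2)
open T4HaarSU2ExpChart (expPoint)
open T4CubeChartExp (expPt toE)
open B15SU2ChartHolomorphic (expPointC coe_expPoint_eq_expPointC)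
open Summit.QuantumFields.YangMills.Theorems.OrganTangentTelescopeWindowPath (firstDiff_step_on clause_update_of_HClauseSq)
open Summit.QuantumFields.YangMills.Theorems.OrganTangentSmallStepOneBond (plaqDev_update_le)

namespace Summit.QuantumFields.YangMills.Cruxes.FluctuationComparisonRegPrIntL.GRAnchorFree

/-! ## §1 The chart is odd-to-inverse (restated from `GRChartOdd.lean` (ii′), self-contained) -/

/-- `expPointC (−z) = (expPointC z)⁻¹` (`e^{−M} = (e^{M})⁻¹`). [folklore] -/
theorem expPointC_neg (z : EuclideanSpace ℂ (Fin 3)) : expPointC (-z) = (expPointC z)⁻¹ := by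
  rw [expPointC, expPointC, ← Matrix.exp_neg]
  congr 1
  rw [← Finset.sum_neg_distrib]
  refine Finset.sum_congr rfl fun a _ => ?_
  simp [neg_smul]

/-- In `SU(2)` the inverse, read in matrices, is the matrix inverse. [folklore] -/
theorem coe_inv_eq_matrix_inv (g : SU2) : ((g⁻¹ : SU2) : Matrix (Fin 2) (Fin 2) ℂ) = (g : Matrix (Fin 2) (Fin 2) ℂ)⁻¹ := by
  have hU : (g : Matrix (Fin 2) (Fin 2) ℂ) * star (g : Matrix (Fin 2) (Fin 2) ℂ) = 1 :=
    Matrix.mem_unitaryGroup_iff.1 (Matrix.mem_specialUnitaryGroup_iff.1 g.2).1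
  rw [Matrix.inv_eq_right_inv hU]
  rfl

/-- `expPoint (−x) = (expPoint x)⁻¹` in `SU(2)`. [folklore] -/
theorem expPoint_neg (x : EuclideanSpace ℝ (Fin 3)) : expPoint (-x) = (expPoint x)⁻¹ := by
  apply Subtype.ext
  rw [coe_inv_eq_matrix_inv, coe_expPoint_eq_expPointC, coe_expPoint_eq_expPointC, ← expPointC_neg]
  congr 1
  ext a
  simp

/-- ★ `expPt (−v) = (expPt v)⁻¹`: the one-bond exponential chart is odd-to-inverse. [folklore] -/
theorem expPt_neg (v : Fin 3 → ℝ) : expPt (-v) = (expPt v)⁻¹ := by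
  rw [expPt, expPt, ← expPoint_neg]
  rfl

/-- `expPt v · expPt (−v) = 1`. [folklore] -/
theorem expPt_mul_expPt_neg (v : Fin 3 → ℝ) : expPt v * expPt (-v) = 1 := by
  rw [expPt_neg, mul_inv_cancel]

/-- `dist1 (expPt (−v)) = dist1 (expPt v)`. [folklore] -/
theorem dist1_expPt_neg (v : Fin 3 → ℝ) : dist1 (expPt (-v)) = dist1 (expPt v) := by
  rw [expPt_neg, GaugeGroup.dist1_inv]

/-! ## §2 Abstract sup-oscillation along a path of moves (windowed clause, moving anchors) -/

section Abstract

variable {X ι M : Type*}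

/-- ★ **SUP-OSCILLATION ALONG A PATH** from the windowed pair clause: if at the start `U₀` every step `q` of the path has an anchor
`|f (act U₀ q) − f U₀| ≤ A·sz q` (`0 ≤ A`), every pair of steps has column entry `k p.1 q.1·sz p.2 ≤ κ` (`0 ≤ κ`), steps have size `0 ≤ sz ≤ σ`
(`σ ≥ 0`) and `≤ ρ`, and every prefix of the path together with its excitation by every step is `Good`, then
`|f Uend − f U₀| ≤ n·(A + n·κ)·σ`, `n` the number of steps.  (Induction with MOVING ANCHORS: across one step the anchor constant grows by `κ`,
brick T's `firstDiff_step_on`.) [folklore] -/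
theorem osc_of_anchor_and_length_on (Good : X → Prop) (ρ : ℝ) (act : X → ι → M → X) (sz : M → ℝ) (f : X → ℝ) (k : ι → ι → ℝ)
    (hH : ∀ (U : X) (b b' : ι) (m m' : M), Good U → Good (act U b m) → Good (act U b' m') → Good (act (act U b m) b' m') →
      sz m ≤ ρ → sz m' ≤ ρ → |f (act (act U b m) b' m') - f (act U b m) - f (act U b' m') + f U| ≤ k b b' * sz m * sz m')
    {σ κ : ℝ} (hσ : 0 ≤ σ) (hκ : 0 ≤ κ) :
    ∀ (path : List (ι × M)) (U₀ : X) (A : ℝ), 0 ≤ A →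
      (∀ q ∈ path, sz q.2 ≤ ρ) → (∀ q ∈ path, 0 ≤ sz q.2) → (∀ q ∈ path, sz q.2 ≤ σ) →
      (∀ p ∈ path, ∀ q ∈ path, k p.1 q.1 * sz p.2 ≤ κ) →
      (∀ n ≤ path.length, Good ((path.take n).foldl (fun V p => act V p.1 p.2) U₀) ∧
        ∀ q ∈ path, Good (act ((path.take n).foldl (fun V p => act V p.1 p.2) U₀) q.1 q.2)) →
      (∀ q ∈ path, |f (act U₀ q.1 q.2) - f U₀| ≤ A * sz q.2) →
      |f (path.foldl (fun V p => act V p.1 p.2) U₀) - f U₀| ≤ path.length * (A + path.length * κ) * σ := by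
  intro path
  induction path with
  | nil =>
    intro U₀ A _ _ _ _ _ _ _
    simp
  | cons p ps ih =>
    intro U₀ A hA hρ hnn hsz hcol hgood hanc
    -- the window facts at the start: `U₀`, `U₁ := act U₀ p`, and their excitations by every later step
    have h0 := hgood 0 (Nat.zero_le _)
    have h1 := hgood 1 (by simp)
    simp only [List.take_zero, List.foldl_nil] at h0
    simp only [List.take_succ_cons, List.take_zero, List.foldl_cons, List.foldl_nil] at h1
    have hp : p ∈ p :: ps := by simp
    -- the first step, from its own anchor
    have hfirst : |f (act U₀ p.1 p.2) - f U₀| ≤ A * σ :=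
      (hanc p hp).trans (mul_le_mul_of_nonneg_left (hsz p hp) hA)
    -- moved anchors at `U₁` for the remaining steps: constant `A + κ`
    have hanc' : ∀ q ∈ ps, |f (act (act U₀ p.1 p.2) q.1 q.2) - f (act U₀ p.1 p.2)| ≤ (A + κ) * sz q.2 := by
      intro q hq
      have hq' : q ∈ p :: ps := List.mem_cons_of_mem p hq
      have hstep := firstDiff_step_on Good ρ act sz f k hH U₀ p q.1 q.2 h0.1 h1.1 (h0.2 q hq') (h1.2 q hq')
        (hρ p hp) (hρ q hq') A (hanc q hq')
      refine hstep.trans (mul_le_mul_of_nonneg_right ?_ (hnn q hq'))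
      linarith [hcol p hp q hq']
    have hgood' : ∀ n ≤ ps.length, Good ((ps.take n).foldl (fun V p => act V p.1 p.2) (act U₀ p.1 p.2)) ∧
        ∀ q ∈ ps, Good (act ((ps.take n).foldl (fun V p => act V p.1 p.2) (act U₀ p.1 p.2)) q.1 q.2) := by
      intro n hn
      have := hgood (n + 1) (by simpa using hn)
      simp only [List.take_succ_cons, List.foldl_cons] at this
      exact ⟨this.1, fun q hq => this.2 q (List.mem_cons_of_mem p hq)⟩
    have hIH := ih (act U₀ p.1 p.2) (A + κ) (add_nonneg hA hκ)
      (fun q hq => hρ q (List.mem_cons_of_mem p hq)) (fun q hq => hnn q (List.mem_cons_of_mem p hq))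
      (fun q hq => hsz q (List.mem_cons_of_mem p hq))
      (fun p' hp' q hq => hcol p' (List.mem_cons_of_mem p hp') q (List.mem_cons_of_mem p hq)) hgood' hanc'
    rw [List.foldl_cons]
    have hlen : ((p :: ps).length : ℝ) = (ps.length : ℝ) + 1 := by
      rw [List.length_cons]; push_cast; ring
    rw [hlen]
    have hm : (0 : ℝ) ≤ ps.length := Nat.cast_nonneg _
    have hpos : 0 ≤ ((ps.length : ℝ) + 1) * κ * σ := by positivity
    have e : ((ps.length : ℝ) + 1) * (A + ((ps.length : ℝ) + 1) * κ) * σ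
        = ((ps.length : ℝ) * ((A + κ) + (ps.length : ℝ) * κ) * σ + A * σ) + ((ps.length : ℝ) + 1) * κ * σ := by ring
    calc |f (ps.foldl (fun V p => act V p.1 p.2) (act U₀ p.1 p.2)) - f U₀|
        ≤ |f (ps.foldl (fun V p => act V p.1 p.2) (act U₀ p.1 p.2)) - f (act U₀ p.1 p.2)| + |f (act U₀ p.1 p.2) - f U₀| :=
          abs_sub_le _ _ _
      _ ≤ (ps.length : ℝ) * ((A + κ) + (ps.length : ℝ) * κ) * σ + A * σ := add_le_add hIH hfirst
      _ ≤ ((ps.length : ℝ) + 1) * (A + ((ps.length : ℝ) + 1) * κ) * σ := by rw [e]; linarith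

end Abstract

/-! ## §3 The organ: anchor-free anchors and the sup-oscillation along a window path from `1` -/

section Organ

variable {P : Params} {j : ℕ} [DecidableEq (PBond P j)]

/-- ★★ **TN-ANCHOR-FREE — THE ANCHOR LETTER FROM THE CLAUSE ITSELF.**  For the `HClauseSq` TEXT `h` (window `θ`, move cap `r·θ`, letters `k`),
a base point `U₀`, a bond `b` and a move `v` (`‖v‖∕θ ≤ r`) with `U₀`, `V := U₀·e^{v}` at `b` and `W := U₀·e^{−v}` at `b` all `θ`-small, and
EVENNESS `R W = R V`: the clause's square at `b′ = b`, `v′ = −v` closes back at `Z = U₀` and reads `|2(R U₀ − R V)| ≤ k b b·(‖v‖∕θ)²`, so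
`|R V − R U₀| ≤ (k b b ∕ 2)·(‖v‖∕θ)·(‖v‖∕θ)`. [folklore] -/
theorem anchor_of_clause_of_even {θ r : ℝ} (hθ : 0 < θ) {k : PBond P j → PBond P j → ℝ} {R : GaugeField P j SU2 → ℝ}
    (h : ∀ (b b' : PBond P j) (v v' : Fin 3 → ℝ) (U V W Z : GaugeField P j (Matrix.specialUnitaryGroup (Fin 2) ℂ)),
      ‖v‖ ≤ r * θ → ‖v'‖ ≤ r * θ → PlaqSmall θ U → PlaqSmall θ V → PlaqSmall θ W → PlaqSmall θ Z →
      (∀ e, e ≠ b → V e = U e) → V b = U b * expPt v → (∀ e, e ≠ b' → W e = U e) → W b' = U b' * expPt v' →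
      (∀ e, e ≠ b' → Z e = V e) → Z b' = V b' * expPt v' →
      |R Z - R V - R W + R U| ≤ k b b' * (‖v‖ / θ) * (‖v'‖ / θ))
    (U₀ : GaugeField P j SU2) (b : PBond P j) (v : Fin 3 → ℝ) (hv : ‖v‖ / θ ≤ r)
    (hU : PlaqSmall θ U₀) (hV : PlaqSmall θ (update U₀ b (U₀ b * expPt v))) (hW : PlaqSmall θ (update U₀ b (U₀ b * expPt (-v))))
    (heven : R (update U₀ b (U₀ b * expPt (-v))) = R (update U₀ b (U₀ b * expPt v))) :
    |R (update U₀ b (U₀ b * expPt v)) - R U₀| ≤ k b b / 2 * (‖v‖ / θ) * (‖v‖ / θ) := by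
  have hv1 : ‖v‖ ≤ r * θ := by rwa [div_le_iff₀ hθ] at hv
  have hv2 : ‖-v‖ ≤ r * θ := by rwa [norm_neg]
  have hsq := h b b v (-v) U₀ (update U₀ b (U₀ b * expPt v)) (update U₀ b (U₀ b * expPt (-v))) U₀ hv1 hv2 hU hV hW hU
    (fun e he => update_of_ne he _ _) (update_self _ _ _)
    (fun e he => update_of_ne he _ _) (update_self _ _ _)
    (fun e he => (update_of_ne he _ _).symm)
    (by rw [update_self, mul_assoc, expPt_mul_expPt_neg, mul_one])
  rw [norm_neg, heven] at hsq
  have e1 : R U₀ - R (update U₀ b (U₀ b * expPt v)) - R (update U₀ b (U₀ b * expPt v)) + R U₀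
      = -(2 * (R (update U₀ b (U₀ b * expPt v)) - R U₀)) := by ring
  rw [e1, abs_neg, abs_mul, abs_two] at hsq
  have e2 : k b b / 2 * (‖v‖ / θ) * (‖v‖ / θ) = k b b * (‖v‖ / θ) * (‖v‖ / θ) / 2 := by ring
  rw [e2, le_div_iff₀ two_pos]
  linarith

omit [DecidableEq (PBond P j)] in
/-- The flat configuration's bond variables are `1`. [folklore] -/
theorem one_apply (b : PBond P j) : (1 : GaugeField P j SU2) b = 1 := rfl

omit [DecidableEq (PBond P j)] in
/-- The flat configuration is `θ`-small for every `θ > 0`. [folklore] -/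
theorem plaqSmall_one {θ : ℝ} (hθ : 0 < θ) : PlaqSmall θ (1 : GaugeField P j SU2) := by
  intro p
  have h1 : GaugeField.plaqHol (1 : GaugeField P j SU2) p = 1 := by
    show (1 : SU2) * 1 * (1 : SU2)⁻¹ * (1 : SU2)⁻¹ = 1
    simp
  rw [h1, GaugeGroup.dist1_one]; exact hθ

/-- A one-bond excitation of the flat configuration by `g` with `dist1 g < θ` is `θ`-small (a bond occurs at most once in a plaquette boundary,
P-a's `plaqDev_update_le`). [folklore] -/
theorem plaqSmall_update_one_of_dist1_lt {θ : ℝ} (b : PBond P j) (g : SU2) (hg : dist1 g < θ) :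
    PlaqSmall θ (update (1 : GaugeField P j SU2) b ((1 : GaugeField P j SU2) b * g)) := by
  intro p
  have h1 : GaugeField.plaqHol (1 : GaugeField P j SU2) p = 1 := by
    show (1 : SU2) * 1 * (1 : SU2)⁻¹ * (1 : SU2)⁻¹ = 1
    simp
  calc dist1 (GaugeField.plaqHol (update (1 : GaugeField P j SU2) b ((1 : GaugeField P j SU2) b * g)) p)
      ≤ dist1 (GaugeField.plaqHol (1 : GaugeField P j SU2) p) + T4ExpWindowSmallField.plaqDev (update 1 b ((1 : GaugeField P j SU2) b * g)) 1 p :=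
        T4ExpWindowSmallField.dist1_plaqHol_le_add _ _ p
    _ ≤ 0 + dist1 g := by
        rw [h1, GaugeGroup.dist1_one]
        exact add_le_add le_rfl (plaqDev_update_le 1 b g p)
    _ < θ := by rw [zero_add]; exact hg

/-- ★ **THE FLAT ANCHOR FROM THE CLAUSE**: at `U₀ = 1`, with inversion-evenness `R (update 1 b g⁻¹) = R (update 1 b g)` (the tree's ✓p793256
`…FlatAnchorEven.flatBond_apply_inv_eq` for gauge-invariant `R`) and `dist1 (expPt v) < θ`, the clause alone gives the second-order anchor
letter `G := (k b b ∕ 2)·(‖v‖∕θ)` in the shape brick T's `firstDiff_window_path` eats. [folklore] -/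
theorem flat_anchor_of_clause {θ r : ℝ} (hθ : 0 < θ) {k : PBond P j → PBond P j → ℝ} {R : GaugeField P j SU2 → ℝ}
    (h : ∀ (b b' : PBond P j) (v v' : Fin 3 → ℝ) (U V W Z : GaugeField P j (Matrix.specialUnitaryGroup (Fin 2) ℂ)),
      ‖v‖ ≤ r * θ → ‖v'‖ ≤ r * θ → PlaqSmall θ U → PlaqSmall θ V → PlaqSmall θ W → PlaqSmall θ Z →
      (∀ e, e ≠ b → V e = U e) → V b = U b * expPt v → (∀ e, e ≠ b' → W e = U e) → W b' = U b' * expPt v' →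
      (∀ e, e ≠ b' → Z e = V e) → Z b' = V b' * expPt v' →
      |R Z - R V - R W + R U| ≤ k b b' * (‖v‖ / θ) * (‖v'‖ / θ))
    (hinv : ∀ (b : PBond P j) (g : SU2), R (update 1 b g⁻¹) = R (update 1 b g))
    (b : PBond P j) (v : Fin 3 → ℝ) (hv : ‖v‖ / θ ≤ r) (hvθ : dist1 (expPt v) < θ) :
    |R (update 1 b ((1 : GaugeField P j SU2) b * expPt v)) - R 1| ≤ (k b b / 2 * (‖v‖ / θ)) * (‖v‖ / θ) := by
  have hV : PlaqSmall θ (update (1 : GaugeField P j SU2) b ((1 : GaugeField P j SU2) b * expPt v)) :=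
    plaqSmall_update_one_of_dist1_lt b (expPt v) hvθ
  have hW : PlaqSmall θ (update (1 : GaugeField P j SU2) b ((1 : GaugeField P j SU2) b * expPt (-v))) :=
    plaqSmall_update_one_of_dist1_lt b (expPt (-v)) (by rwa [dist1_expPt_neg])
  have heven : R (update 1 b ((1 : GaugeField P j SU2) b * expPt (-v))) = R (update 1 b ((1 : GaugeField P j SU2) b * expPt v)) := by
    rw [one_apply, one_mul, one_mul, expPt_neg, hinv]
  exact anchor_of_clause_of_even hθ h 1 b v hv (plaqSmall_one hθ) hV hW heven

/-- ★★ **TN-OSC — SUP-OSCILLATION OF THE REMAINDER ALONG A WINDOW PATH FROM `1`.**  For the `HClauseSq` TEXT `h`, inversion-evenness at the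
flat anchor (`hinv`), nonnegative letters bounded by `K` on the path's bonds, a path of `n` right exponential moves `(bᵢ, vᵢ)` from `1` with
`‖vᵢ‖∕θ ≤ σ ≤ r`, `dist1 (expPt vᵢ) < θ`, and every prefix together with its excitation by every step `θ`-small:
`|R Uend − R 1| ≤ n·(K·σ∕2 + n·(K·σ))·σ` — the second-order Taylor bound along a path of scaled length `n·σ`.  (§2 with Good = `PlaqSmall θ`,
anchors `A := K·σ∕2` from `flat_anchor_of_clause`, column bound `κ := K·σ`.) [folklore] -/
theorem osc_flat_window_path_le {θ r : ℝ} (hθ : 0 < θ) {k : PBond P j → PBond P j → ℝ} {R : GaugeField P j SU2 → ℝ}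
    (h : ∀ (b b' : PBond P j) (v v' : Fin 3 → ℝ) (U V W Z : GaugeField P j (Matrix.specialUnitaryGroup (Fin 2) ℂ)),
      ‖v‖ ≤ r * θ → ‖v'‖ ≤ r * θ → PlaqSmall θ U → PlaqSmall θ V → PlaqSmall θ W → PlaqSmall θ Z →
      (∀ e, e ≠ b → V e = U e) → V b = U b * expPt v → (∀ e, e ≠ b' → W e = U e) → W b' = U b' * expPt v' →
      (∀ e, e ≠ b' → Z e = V e) → Z b' = V b' * expPt v' →
      |R Z - R V - R W + R U| ≤ k b b' * (‖v‖ / θ) * (‖v'‖ / θ))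
    (hinv : ∀ (b : PBond P j) (g : SU2), R (update 1 b g⁻¹) = R (update 1 b g))
    {K σ : ℝ} (hK : 0 ≤ K) (hσ : 0 ≤ σ) (hσr : σ ≤ r)
    (path : List (PBond P j × (Fin 3 → ℝ)))
    (hk : ∀ p ∈ path, ∀ q ∈ path, 0 ≤ k p.1 q.1 ∧ k p.1 q.1 ≤ K)
    (hsz : ∀ q ∈ path, ‖q.2‖ / θ ≤ σ) (hdist : ∀ q ∈ path, dist1 (expPt q.2) < θ)
    (hgood : ∀ n ≤ path.length,
      PlaqSmall θ ((path.take n).foldl (fun U p => update U p.1 (U p.1 * expPt p.2)) (1 : GaugeField P j SU2)) ∧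
      ∀ q ∈ path, PlaqSmall θ (update ((path.take n).foldl (fun U p => update U p.1 (U p.1 * expPt p.2)) (1 : GaugeField P j SU2)) q.1
        (((path.take n).foldl (fun U p => update U p.1 (U p.1 * expPt p.2)) (1 : GaugeField P j SU2)) q.1 * expPt q.2))) :
    |R (path.foldl (fun U p => update U p.1 (U p.1 * expPt p.2)) (1 : GaugeField P j SU2)) - R 1|
      ≤ path.length * (K * σ / 2 + path.length * (K * σ)) * σ := by
  have hnn : ∀ q ∈ path, 0 ≤ ‖q.2‖ / θ := fun q _ => div_nonneg (norm_nonneg _) hθ.le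
  refine osc_of_anchor_and_length_on (PlaqSmall θ) r
    (fun (U : GaugeField P j SU2) (b : PBond P j) (v : Fin 3 → ℝ) => update U b (U b * expPt v))
    (fun w : Fin 3 → ℝ => ‖w‖ / θ) R k (clause_update_of_HClauseSq hθ h) hσ (by positivity : 0 ≤ K * σ) path 1 (K * σ / 2)
    (by positivity) (fun q hq => (hsz q hq).trans hσr) hnn hsz ?_ hgood ?_
  · -- column entries `k p.1 q.1 · (‖p.2‖∕θ) ≤ K·σ`
    intro p hp q hq
    exact mul_le_mul (hk p hp q hq).2 (hsz p hp) (hnn p hp) hK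
  · -- anchors at `1` from the clause itself: `(k b b ∕ 2)·s·s ≤ (K·σ∕2)·s`
    intro q hq
    have ha := flat_anchor_of_clause hθ h hinv q.1 q.2 ((hsz q hq).trans hσr) (hdist q hq)
    refine ha.trans (mul_le_mul_of_nonneg_right ?_ (hnn q hq))
    have h1 : k q.1 q.1 / 2 ≤ K / 2 := by linarith [(hk q hq q hq).2]
    calc k q.1 q.1 / 2 * (‖q.2‖ / θ) ≤ K / 2 * σ :=
          mul_le_mul h1 (hsz q hq) (hnn q hq) (by linarith)
      _ = K * σ / 2 := by ring

end Organ

end Summit.QuantumFields.YangMills.Cruxes.FluctuationComparisonRegPrIntL.GRAnchorFree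

end
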